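import Summits.ABC.ABC.Theses.DefiniteXi
import Literature.NumberTheory.Automorphic.FontaineMazurGL2OddPrime
import Literature.NumberTheory.GaloisRepresentations.OrdinaryTwistedDeterminant
import Literature.NumberTheory.GaloisRepresentations.ResidualQuadraticField
import Literature.NumberTheory.Automorphic.CDTTheorem712
import Literature.NumberTheory.Automorphic.LanglandsTunnellModThree
import Literature.NumberTheory.EllipticCurves.FramedTateGaloisRep
import HarnessLib

/-!
# Stub ideas for `stub_modThree` — ideator k = 3, GENERATION 3 (home family 3: probe the extremes)

Typed helper signatures for `STUB-IDEAS-stub_modThree-3.md` (gen 3).  `sorry` only inside the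
helper stubs `stubA1 … stubW`; the assembly `stub_modThree_of_planG3`, the shape certificate
`allenOutput_of_fact` (the hypotheses/conclusion below are VERBATIM those of the catalogued fact
`Allen2014_modularity_nearlyOrdinaryDihedral_Q`), `cyclicSix_comm` and the closers from
`langlands_tunnell` are proved.  Nothing here is registered; the skeleton `Lines/Sketch.lean` is untouched.
-/

set_option linter.dupNamespace false

noncomputable section

open scoped MatrixGroups Matrix NumberField ModularForm
open NumberField IsDedekindDomain Field Filter CongruenceSubgroup
open Literature.NumberTheory.EllipticCurves
open Literature.NumberTheory.EllipticCurves.ModularForms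
open Literature.NumberTheory.Automorphic
open Literature.NumberTheory.Automorphic.BCDT
open Literature.NumberTheory.GaloisRepresentations
open WeierstrassCurve

namespace Summit.ABC.ABC.Cruxes.FreyModularity.StubIdeasModThree3G3

/-- The statement of `stub_modThree` (verbatim). -/
abbrev SigStubModThree : Prop :=
  ∀ (W : WeierstrassCurve ℚ) [W.IsElliptic] (ρ : ModPGaloisRep ℚ (ZMod 3) 2),
    W.IsTorsionGaloisRep 3 ρ → FramedRep.IsAbsolutelyIrreducible ρ → ρ.IsModular

/-! ## R — the exact reach of the 3–2 road: inertia above 2 acts on `E[3]` through a cyclic group of order ∣ 6 -/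

/-- `E[3]|_{I_2}` is `ψ ⊗ unipotent` (`ψ` of order ≤ 2): inertia above `2` acts on `E[3](ℚ̄)`
through the powers of one element of order dividing `6`. -/
def CyclicSixInertiaAtTwo (W : WeierstrassCurve ℚ) [W.IsElliptic] : Prop :=
  ∀ v : HeightOneSpectrum (𝓞 ℚ), (2 : 𝓞 ℚ) ∈ v.asIdeal → ∀ 𝔓 ∈ v.primesAbove,
    ∃ σ₀ ∈ 𝔓.inertia (absoluteGaloisGroup ℚ), (∀ T : geomTorsion W 3, (σ₀ ^ 6) • T = T) ∧
      ∀ σ ∈ 𝔓.inertia (absoluteGaloisGroup ℚ), ∃ n : ℕ, ∀ T : geomTorsion W 3, σ • T = (σ₀ ^ n) • T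

/-- A cyclic inertia action is commutative (so the landed `stub_swanOddNonabelianInertia` certifies
`¬ CyclicSixInertiaAtTwo` on the odd-Swan Frey classes). -/
theorem cyclicSix_comm {W : WeierstrassCurve ℚ} [W.IsElliptic] (h : CyclicSixInertiaAtTwo W)
    (v : HeightOneSpectrum (𝓞 ℚ)) (hv : (2 : 𝓞 ℚ) ∈ v.asIdeal) (𝔓) (h𝔓 : 𝔓 ∈ v.primesAbove) :
    ∀ σ₁ ∈ 𝔓.inertia (absoluteGaloisGroup ℚ), ∀ σ₂ ∈ 𝔓.inertia (absoluteGaloisGroup ℚ),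
      ∀ T : geomTorsion W 3, (σ₁ * σ₂) • T = (σ₂ * σ₁) • T := by
  obtain ⟨σ₀, -, -, hσ₀⟩ := h v hv 𝔓 h𝔓
  intro σ₁ hσ₁ σ₂ hσ₂ T
  obtain ⟨n₁, hn₁⟩ := hσ₀ σ₁ hσ₁
  obtain ⟨n₂, hn₂⟩ := hσ₀ σ₂ hσ₂
  rw [mul_smul, mul_smul, hn₂ T, hn₁ (σ₀ ^ n₂ • T), hn₁ T, hn₂ (σ₀ ^ n₁ • T), ← mul_smul,
    ← mul_smul, ← pow_add, ← pow_add, add_comm]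


/-- VERBATIM copy of the catalogued named fact
`Literature.NumberTheory.Automorphic.Allen2014_modularity_nearlyOrdinaryDihedral_Q`
(`Automorphic/FontaineMazurGL2DyadicNearlyOrdinaryDihedral.lean`, l.134; that module was not built on
the farm snapshot when this sketch was checked, so the text is inlined; `Iff.rfl` against the fact). -/
def AllenFact : Prop :=
  ∀ (ρ : FramedGaloisRep ℚ (PadicAlgCl 2) 2),
    (∀ᶠ v : HeightOneSpectrum (𝓞 ℚ) in cofinite, ρ.IsUnramifiedAt v) → ρ.IsOdd →
    ρ.IsResiduallyAbsIrreducible → IsSolvable ρ.residualRep.range →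
    AllenConditionFive ρ.residualRep →
    (∃ (χ₀ : absoluteGaloisGroup ℚ →ₜ* (PadicAlgCl 2)ˣ) (a : ℤ) (k m : ℕ),
      (∀ σ, χ₀ σ = cyclotomicPadicAlgCl ℚ 2 σ ^ a) ∧ 2 ≤ k ∧ 0 < m ∧
      (∀ v : HeightOneSpectrum (𝓞 ℚ), ((2 : ℕ) : 𝓞 ℚ) ∈ v.asIdeal →
        FramedGaloisRep.IsOrdinaryOfWeightAt 2 (FramedRep.twist ρ χ₀) v k m) ∧
      ∃ n : ℕ, 0 < n ∧ ∀ σ,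
        (FramedRep.det (FramedRep.twist ρ χ₀) σ * (cyclotomicPadicAlgCl ℚ 2 σ ^ ((k : ℤ) - 1))⁻¹) ^ n = 1) →
    ∃ (χ : absoluteGaloisGroup ℚ →ₜ* (PadicAlgCl 2)ˣ) (m : ℤ),
      (∀ σ, χ σ = cyclotomicPadicAlgCl ℚ 2 σ ^ m) ∧
      ∃ (N : ℕ) (_ : NeZero N) (k : ℤ) (f : CuspForm (Gamma1 N) k)
        (ιf : coeffCharField f →+* PadicAlgCl 2),
        IsNewform1 f ∧ IsGaloisRepOfNewform1 f ιf {q | q ∣ N * 2} (FramedRep.twist ρ χ)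

/-! ## The switch data and the interface to the catalogued fact `Allen2014_modularity_nearlyOrdinaryDihedral_Q` -/

/-- The curve the 3–2 switch must produce: potentially multiplicative at `2` (`v₂(j) < 0`), no
rational `2`-torsion, `Δ` a positive non-square (so `ℚ(E''[2]) ` has group `S₃` with REAL quadratic
resolvent `ℚ(√Δ)`: Allen's condition (5) is void, `AllenConditionFive.of_isTotallyReal`). -/
def SwitchData (W : WeierstrassCurve ℚ) [W.IsElliptic] : Prop :=
  padicValRat 2 W.j < 0 ∧ (∀ x : ℚ, ¬ W.twoTorsionPolynomial.toPoly.IsRoot x) ∧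
    ¬ IsSquare W.Δ ∧ 0 < W.Δ

/-- The hypotheses of `Allen2014_modularity_nearlyOrdinaryDihedral_Q` on `ρ` (verbatim). -/
def AllenHypotheses (ρ : FramedGaloisRep ℚ (PadicAlgCl 2) 2) : Prop :=
  (∀ᶠ v : HeightOneSpectrum (𝓞 ℚ) in cofinite, ρ.IsUnramifiedAt v) ∧ ρ.IsOdd ∧
    ρ.IsResiduallyAbsIrreducible ∧ IsSolvable ρ.residualRep.range ∧
    AllenConditionFive ρ.residualRep ∧
    ∃ (χ₀ : absoluteGaloisGroup ℚ →ₜ* (PadicAlgCl 2)ˣ) (a : ℤ) (k m : ℕ),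
      (∀ σ, χ₀ σ = cyclotomicPadicAlgCl ℚ 2 σ ^ a) ∧ 2 ≤ k ∧ 0 < m ∧
      (∀ v : HeightOneSpectrum (𝓞 ℚ), ((2 : ℕ) : 𝓞 ℚ) ∈ v.asIdeal →
        FramedGaloisRep.IsOrdinaryOfWeightAt 2 (FramedRep.twist ρ χ₀) v k m) ∧
      ∃ n : ℕ, 0 < n ∧ ∀ σ,
        (FramedRep.det (FramedRep.twist ρ χ₀) σ * (cyclotomicPadicAlgCl ℚ 2 σ ^ ((k : ℤ) - 1))⁻¹) ^ n = 1

/-- The conclusion of `Allen2014_modularity_nearlyOrdinaryDihedral_Q` for `ρ` (verbatim): a Tate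
twist `ρ ⊗ ε₂^m` is attached to a newform AWAY FROM `{q ∣ 2N}` — note `2 ∈ S` always and `m`,
the weight and the level are not controlled. -/
def AllenOutput (ρ : FramedGaloisRep ℚ (PadicAlgCl 2) 2) : Prop :=
  ∃ (χ : absoluteGaloisGroup ℚ →ₜ* (PadicAlgCl 2)ˣ) (m : ℤ),
    (∀ σ, χ σ = cyclotomicPadicAlgCl ℚ 2 σ ^ m) ∧
    ∃ (N : ℕ) (_ : NeZero N) (k : ℤ) (f : CuspForm (Gamma1 N) k)
      (ιf : coeffCharField f →+* PadicAlgCl 2),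
      IsNewform1 f ∧ IsGaloisRepOfNewform1 f ιf {q | q ∣ N * 2} (FramedRep.twist ρ χ)

/-- Shape certificate: the two definitions above are exactly the fact's hypotheses and conclusion. -/
theorem allenOutput_of_fact (hAllen : AllenFact)
    (ρ : FramedGaloisRep ℚ (PadicAlgCl 2) 2) (h : AllenHypotheses ρ) : AllenOutput ρ := by
  obtain ⟨h1, h2, h3, h4, h5, h6⟩ := h
  exact hAllen ρ h1 h2 h3 h4 h5 h6

/-! ## Helper stubs (gen 3) -/

/-- **A1 (dictionary, M–L).** For switch data, `ρ_{E'',2} = E''.framedTateGaloisRep 2` satisfies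
Allen's hypotheses with `a = 0`, `k = m = 2`, `n = 1`: a.e. unramified
(`eventually_isUnramifiedAt_framedTateGaloisRep`, in tree); odd and `det = ε₂` (Weil pairing);
`residualRep ≃ E''[2]` with image `S₃` (irreducible cubic, non-square `Δ`) hence absolutely
irreducible and solvable; `residualQuadraticField = ℚ(√Δ)` real ⇒ `AllenConditionFive.of_isTotallyReal`;
`IsOrdinaryOfWeightAt 2 ρ v 2 2` from Tate's uniformisation at `2` (`v₂(j) < 0`). -/
theorem stubA1_allenHypotheses_of_switchData :
    ∀ (W'' : WeierstrassCurve ℚ) [W''.IsElliptic], SwitchData W'' →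
      AllenHypotheses (W''.framedTateGaloisRep 2) := by
  sorry

/-- **A3 (residual descent, L).** From Allen's output for `ρ_{E'',2}` to `ρ̄ ≅ E''[3]` modular:
(i) the Hecke packet `ι_f(a_q f) = q^m a_q(E'')`, `k = 2m+2`, trivial nebentypus, for `q ∤ 2 N N_{E''}`
(`hasFrobCharpolyAt_framedTateGaloisRep_iff` + `trace_galoisRepTate_frobenius_of_hasGoodReductionAt_holds`);
(ii) `2 ∣ N_f` because `E''` is bad at `2` (Deligne's `ρ_{f,λ}`, `λ ∣ 3`, `exists_padicGaloisRep_of_isNewform1`,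
Brauer–Nesbitt/Chebotarev, irreducibility of `V₃E''`, `neronOggShafarevich_holds`) and odd `q ∣ N_{E''}`
divide `N_f` (NOS for `T₂`); (iii) weight-`k` version of `isModular_of_isNewform0_packet` gives
`(ρ̄ ⊗ χ̄₃^m).IsModular`; (iv) `χ̄₃ = ψ₋₃` is quadratic of conductor `3 = ℓ`: remove it by `stubT`. -/
theorem stubA3_isModular_of_allenOutput :
    ∀ (W'' : WeierstrassCurve ℚ) [W''.IsElliptic] (ρ : ModPGaloisRep ℚ (ZMod 3) 2),
      SwitchData W'' → W''.IsTorsionGaloisRep 3 ρ → FramedRep.IsAbsolutelyIrreducible ρ →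
      AllenOutput (W''.framedTateGaloisRep 2) → ρ.IsModular := by
  sorry

/-- **T (twist by the mod-3 cyclotomic character = the quadratic character of `ℚ(√-3)`, M).**
`IsModular` at `ℓ = 3` is invariant under `⊗ χ̄₃`: `exists_isNewform0_charTwist_packet` (weight `k`,
in tree, with `N ∣ M·9` so no prime other than `3 = ringChar` leaves the level) + the weight-`k`
packet lemma; the support condition of `exists_isNewform0_packet_twist` is void for `m = 3 = ℓ`. -/
theorem stubT_isModular_twist_cyclotomic :
    ∀ (ρ : ModPGaloisRep ℚ (ZMod 3) 2) (χ : absoluteGaloisGroup ℚ →ₜ* (ZMod 3)ˣ),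
      (∀ σ, χ σ = modPCyclotomicCharacterZMod ℚ 3 σ) → ρ.IsModular →
      ModPGaloisRep.IsModular (ρ.twist χ) := by
  sorry

/-- **B2 (local structure at 2, M).** A curve nearly ordinary at `2` (`v₂(j) ≤ 0`: potentially
multiplicative, or potentially good ORDINARY where `Φ₂ ↪ Aut(Ẽ) = ℤ/2` as `j̃ ≠ 0` in
characteristic `2`) has `E[3]|_{I_2} = ψ ⊗ unipotent`, cyclic of order dividing `6`. -/
theorem stubB2_cyclicSix_of_nearlyOrdinary :
    ∀ (W'' : WeierstrassCurve ℚ) [W''.IsElliptic], padicValRat 2 W''.j ≤ 0 →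
      CyclicSixInertiaAtTwo W'' := by
  sorry

/-- **B2t (transport, S).** `CyclicSixInertiaAtTwo` only depends on the Galois module `E[3] ≅ ρ̄`. -/
theorem stubB2t_cyclicSix_transport :
    ∀ (W W'' : WeierstrassCurve ℚ) [W.IsElliptic] [W''.IsElliptic] (ρ : ModPGaloisRep ℚ (ZMod 3) 2),
      W.IsTorsionGaloisRep 3 ρ → W''.IsTorsionGaloisRep 3 ρ →
      CyclicSixInertiaAtTwo W'' → CyclicSixInertiaAtTwo W := by
  sorry

/-- **B3 = N2⁺ (the 3–2 switch on its exact domain, M–L).** If inertia above `2` acts on `E[3]`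
through a cyclic group of order ∣ 6 then the Rubin–Silverberg pencil `X_E(3) ≅ ℙ¹_ℚ` has a
member with the switch data: the local class at `2` is realised by a quadratic twist of a Tate
curve (`H¹(ℚ₂, μ₃) ≅ ℤ/3`, both non-trivial Kummer classes and both symplectic types occur among
`q ∈ 2·ℤ₂^{×3} ∪ 4·ℤ₂^{×3}`), weak approximation at `2, ∞` and Hilbert irreducibility for the cubic. -/
theorem stubB3_switch_plus :
    ∀ (W : WeierstrassCurve ℚ) [W.IsElliptic] (ρ : ModPGaloisRep ℚ (ZMod 3) 2),
      W.IsTorsionGaloisRep 3 ρ → CyclicSixInertiaAtTwo W →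
      ∃ (W'' : WeierstrassCurve ℚ) (_ : W''.IsElliptic), W''.IsTorsionGaloisRep 3 ρ ∧ SwitchData W'' := by
  sorry

/-! ## The residual (extremal configuration) and its closers -/

/-- **The exact residual of the 3–2 road**: `ρ̄ ≅ E[3]` surjective (projectively octahedral) with
inertia above `2` NOT cyclic of order ∣ 6, i.e. `Φ₂ ∈ {C₄, Q₈, SL₂(𝔽₃)}` — potentially
supersingular, wild at `2`.  At the use site: the normalised Frey curves `E_(A,B)`, `A ≡ -1 (4)`,
`2 ∣ B`, `16 ∤ B`, with `ρ̄_{E,3}(Γ_ℚ) = GL₂(𝔽₃)` (odd Swan ⇒ `Q₈ ≤ ρ̄(I₂)`, landed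
`stub_swanOddNonabelianInertia`). -/
def octahedralWildCore : Prop :=
  ∀ (W : WeierstrassCurve ℚ) [W.IsElliptic] (ρ : ModPGaloisRep ℚ (ZMod 3) 2),
    W.IsTorsionGaloisRep 3 ρ → ¬ CyclicSixInertiaAtTwo W → Function.Surjective ρ → ρ.IsModular

/-- The residual is no harder than today's closure (`langlands_tunnell`, via the tree's closer). -/
theorem octahedralWildCore_of_langlands_tunnell (hLT : ∀ σ : FramedArtinRep ℚ 2, langlands_tunnell σ) :
    octahedralWildCore :=
  fun W _ ρ hρ _ hs ↦ W.isModular_of_isTorsionGaloisRep_three_of_langlands_tunnell hLT ρ hρ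
    (isAbsIrreducibleOverSqrt_neg_three_of_surjective ρ hs).isAbsolutelyIrreducible

/-- The dihedral branch (image a Cartan normaliser: `¬` surjective), gen-1/2 `H-D` (k2's CM road or
Hecke's dihedral weight-one case); hypothesis here. -/
def dihedralBranch : Prop :=
  ∀ (W : WeierstrassCurve ℚ) [W.IsElliptic] (ρ : ModPGaloisRep ℚ (ZMod 3) 2),
    W.IsTorsionGaloisRep 3 ρ → FramedRep.IsAbsolutelyIrreducible ρ → ¬ Function.Surjective ρ →
    ρ.IsModular

/-- **W (use-site witness, S–M, certified computation).** `E_(3,2) : y² = x(x-3)(x+2)` (`2 + 3 = 5`,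
`N = 480`) lies in the residual: odd Swan above `2` (landed `stub_freySwanOdd`, class `2 ∥ B`) ⇒
non-commuting inertia (landed `stub_swanOddNonabelianInertia`) ⇒ `¬ CyclicSixInertiaAtTwo`
(`cyclicSix_comm`); and `ρ̄_{E,3}` is surjective (`a₇(E) = 0` with `7 ≡ 1 (3)` ⇒ irreducible;
`v₅(Δ) = 2`, `3 ∤ 2` ⇒ transvection). -/
theorem stubW_coreWitness :
    ∀ [(freyCurve 3 2).IsElliptic], ¬ CyclicSixInertiaAtTwo (freyCurve 3 2) ∧
      ∀ ρ : ModPGaloisRep ℚ (ZMod 3) 2, (freyCurve 3 2).IsTorsionGaloisRep 3 ρ → Function.Surjective ρ := by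
  sorry

/-! ## Assembly (proved) -/

/-- **gen-3 plan:** Allen's catalogued theorem + the dictionary A1 + the residual descent A3 + the
switch B3 settle `stub_modThree` for every `(E, ρ̄)` whose inertia at `2` is cyclic of order ∣ 6
(all curves semistable at `2`, all `-1`-twists of such, all `3–5`-switched curves `W'` of the line);
what is left is the dihedral branch and the octahedral wild core. -/
theorem stub_modThree_of_planG3 (hAllen : AllenFact)
    (hA1 : ∀ (W'' : WeierstrassCurve ℚ) [W''.IsElliptic], SwitchData W'' →
      AllenHypotheses (W''.framedTateGaloisRep 2))
    (hA3 : ∀ (W'' : WeierstrassCurve ℚ) [W''.IsElliptic] (ρ : ModPGaloisRep ℚ (ZMod 3) 2),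
      SwitchData W'' → W''.IsTorsionGaloisRep 3 ρ → FramedRep.IsAbsolutelyIrreducible ρ →
      AllenOutput (W''.framedTateGaloisRep 2) → ρ.IsModular)
    (hB3 : ∀ (W : WeierstrassCurve ℚ) [W.IsElliptic] (ρ : ModPGaloisRep ℚ (ZMod 3) 2),
      W.IsTorsionGaloisRep 3 ρ → CyclicSixInertiaAtTwo W →
      ∃ (W'' : WeierstrassCurve ℚ) (_ : W''.IsElliptic), W''.IsTorsionGaloisRep 3 ρ ∧ SwitchData W'')
    (hD : dihedralBranch) (hCore : octahedralWildCore) : SigStubModThree := by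
  intro W _ ρ hρ hirr
  by_cases hc : CyclicSixInertiaAtTwo W
  · obtain ⟨W'', hW'', hρ'', hsw⟩ := hB3 W ρ hρ hc
    haveI := hW''
    exact hA3 W'' ρ hsw hρ'' hirr (allenOutput_of_fact hAllen _ (hA1 W'' hsw))
  · by_cases hs : Function.Surjective ρ
    · exact hCore W ρ hρ hc hs
    · exact hD W ρ hρ hirr hs

/-- Today's closure of the whole plan from `langlands_tunnell` alone (sanity: the plan's hypotheses
are jointly no stronger than the current skeleton's). -/
theorem sig_of_langlands_tunnell (hLT : ∀ σ : FramedArtinRep ℚ 2, langlands_tunnell σ) :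
    SigStubModThree :=
  fun W _ ρ hρ hirr ↦ W.isModular_of_isTorsionGaloisRep_three_of_langlands_tunnell hLT ρ hρ hirr

end Summit.ABC.ABC.Cruxes.FreyModularity.StubIdeasModThree3G3

end
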